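import Literature.NumberTheory.IwasawaTheory.Fukuda1994Thm1Proofs
import HarnessLib

/-!
# Fukuda 1994, Theorem 1 (1): UNCONDITIONAL consequences (the reading aids of `ClassicalMuInvariant.lean` §5 with the
# named fact discharged by `fukuda1994_thm1_classNumberPExp_const_of_succ_eq_holds`)

Topic `NumberTheory/IwasawaTheory` (namespace = path). THEOREM-ONLY file (no definition, no named fact, no `sorry`), written by the
prover seat `bsd-potss-k8t-c4` g19 (cell `bsd-potss`; Fukuda road of stmt-BirchSwinnertonDyer-19982; closes nothing). The named fact
`fukuda1994_thm1_classNumberPExp_const_of_succ_eq` is PROVED in `Fukuda1994Thm1Proofs.lean`; this small file restates Fukuda's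
Theorem 1 (1) in applicable form and discharges the hypothesis `h : fukuda1994_thm1_classNumberPExp_const_of_succ_eq` of the two
PROVED corollaries `classicalMuVanishes_of_classNumberPExp_succ_eq` / `classNumberPExp_eq_zero_of_succ_eq_zero` of
`ClassicalMuInvariant.lean` §5: for a `ℤ_p`-extension `κ` of a number field with Fukuda index `n₀`, two consecutive layers
`K_n ⊂ K_{n+1}` (`n ≥ n₀`) with the same `p`-class number force `e_m = e_n` for all `m ≥ n`, hence `μ = λ = 0`
(`ClassicalMuVanishes κ`), and `p ∤ h(K_n), p ∤ h(K_{n+1}) ⇒ p ∤ h(K_m)` for all `m ≥ n`.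

References: [Fukuda1994] T. Fukuda, *Remarks on ℤ_p-extensions of number fields*, Proc. Japan Acad. 70 A (1994), Thm. 1 (1), p. 264.
-/

noncomputable section

open scoped NumberField

namespace Literature.NumberTheory.IwasawaTheory

open Literature.NumberTheory.EllipticCurves

variable {K : Type} [Field K] [NumberField K] {p : ℕ} [Fact p.Prime]

/-- **Fukuda 1994, Theorem 1 (1) (applicable form, PROVED).** For a `ℤ_p`-extension `κ` of a number field `K` with Fukuda index
`n₀` (`TotallyRamifiedFrom κ n₀`): if `e_{n+1} = e_n` for some `n ≥ n₀`, then `e_m = e_n` for every `m ≥ n`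
(`e_m = ord_p h(K_m)`). [cite: Fukuda1994, Thm. 1 (1), p. 264] -/
theorem classNumberPExp_eq_of_succ_eq (κ : ZpExtension K p) {n₀ n m : ℕ} (hκ : TotallyRamifiedFrom κ n₀) (hn : n₀ ≤ n)
    (he : classNumberPExp κ (n + 1) = classNumberPExp κ n) (hm : n ≤ m) :
    classNumberPExp κ m = classNumberPExp κ n :=
  fukuda1994_thm1_classNumberPExp_const_of_succ_eq_holds K p κ n₀ hκ n hn he m hm

/-- **`μ = λ = 0` from two consecutive layers with the same `p`-class number (PROVED, unconditional).** Under Fukuda's index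
`n₀ ≤ n`, `e_{n+1} = e_n` gives `ClassicalMuVanishes κ` (growth form `e_m = 0·p^m + 0·m + e_n` for `m ≥ n`) — the printed
«in particular `μ_p(K/k) = λ_p(K/k) = 0`». [cite: Fukuda1994, Thm. 1 (1), p. 264] -/
theorem classicalMuVanishes_of_classNumberPExp_succ_eq' (κ : ZpExtension K p) {n₀ n : ℕ}
    (hκ : TotallyRamifiedFrom κ n₀) (hn : n₀ ≤ n) (he : classNumberPExp κ (n + 1) = classNumberPExp κ n) :
    ClassicalMuVanishes κ :=
  classicalMuVanishes_of_classNumberPExp_succ_eq fukuda1994_thm1_classNumberPExp_const_of_succ_eq_holds κ hκ hn he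

/-- **`p ∤ h(K_n)` and `p ∤ h(K_{n+1})` for one `n ≥ n₀` ⇒ `p ∤ h(K_m)` for all `m ≥ n` (PROVED, unconditional)** — Iwasawa-1956's
conclusion without the «one prime above `p`» hypothesis, from Fukuda's Theorem 1 (1). [cite: Fukuda1994, Thm. 1 (1), p. 264] -/
theorem classNumberPExp_eq_zero_of_succ_eq_zero' (κ : ZpExtension K p) {n₀ n : ℕ}
    (hκ : TotallyRamifiedFrom κ n₀) (hn : n₀ ≤ n) (h0 : classNumberPExp κ n = 0)
    (h1 : classNumberPExp κ (n + 1) = 0) {m : ℕ} (hm : n ≤ m) : classNumberPExp κ m = 0 :=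
  classNumberPExp_eq_zero_of_succ_eq_zero fukuda1994_thm1_classNumberPExp_const_of_succ_eq_holds κ hκ hn h0 h1 hm

/-- **Fukuda index `0` (every ramified prime totally ramified in `K_∞/K`), applicable form (PROVED):** `e_1 = e_0 ⇒ e_m = e_0` for
all `m`. [cite: Fukuda1994, Thm. 1 (1), p. 264] [cite: Washington1997, §13.3 Prop. 13.22 (the case `n₀ = 0`)] -/
theorem classNumberPExp_eq_zero_layer_of_one_eq (κ : ZpExtension K p) (hκ : TotallyRamifiedFrom κ 0)
    (he : classNumberPExp κ 1 = classNumberPExp κ 0) (m : ℕ) :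
    classNumberPExp κ m = classNumberPExp κ 0 :=
  classNumberPExp_eq_of_succ_eq κ hκ le_rfl (by simpa using he) (Nat.zero_le m)

end Literature.NumberTheory.IwasawaTheory

end
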